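import Mathlib
import HarnessLib

/-!
# Route LiouvilleSarnak — support `AlignedTypeI` (stmt-ValiantsHypothesis-21040), line `characters_mod_2n`:
# the binary-rounding block map (a monotone ceiling map with `V p ≤ (1 + 2^{-s}) p` and few values)

Input data for `charSqSum_mul_sq_le_of_blockBounds` (`…BilinearSieve.lean`) via `…BilinearSieveBlocks.lean`: a block map
must satisfy `p ≤ V p`, be SHORT (`V p ≤ (1+δ)p`), be a monotone CEILING map (so that fibre sums are differences of
cumulative prime sums), and take FEW values (`Σ_v β_v/v` runs over the values).  Call `t` *`s`-admissible* when
`2^{⌊log₂ t⌋ − s} ∣ t` (the binary expansion of `t` is supported on its top `s+1` digits).  This file proves, def-free, as ONE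
existence statement `exists_binaryRound`: for every `s` there is `V : ℕ → ℕ` with
(1) `p ≤ V p`; (2) `V p` is `s`-admissible; (3) `V p ≤ t` for every `s`-admissible `t ≥ p` (ceiling; hence monotone and
`V p ≤ V p'` for `p ≤ p'`); (4) `2^s · V p ≤ 2^s · p + p` (shortness `δ = 2^{-s}`); (5) `V p ≤ 2^{⌊log₂ p⌋ + 1}`.
(`V p` = the least `s`-admissible integer `≥ p`; (4) because rounding `p` up to a multiple of `2^{⌊log₂ p⌋ − s}` is admissible.)

HONEST FRAMING. Bookkeeping only; `AlignedTypeI` is NOT closed here; nothing bears on `VP ≠ VNP` (NOT proved).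
-/

set_option linter.dupNamespace false

noncomputable section

namespace Summit.ValiantsHypothesis.ValiantsHypothesis.Theorems.LiouvilleSarnak.AlignedTypeI.CharactersModTwoN

open Finset
open scoped BigOperators

/-- Rounding `p ≥ 1` up to a multiple of `d = 2^{⌊log₂ p⌋ − s}` gives an `s`-admissible integer `c` with
`p ≤ c`, `2^s c ≤ 2^s p + p` and `c ≤ 2^{⌊log₂ p⌋ + 1}`. [folklore] -/
theorem exists_admissible_ge (s p : ℕ) (hp : 1 ≤ p) :
    ∃ c : ℕ, p ≤ c ∧ 2 ^ (Nat.log 2 c - s) ∣ c ∧ 2 ^ s * c ≤ 2 ^ s * p + p ∧ c ≤ 2 ^ (Nat.log 2 p + 1) := by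
  set b := Nat.log 2 p with hb
  have hpb : 2 ^ b ≤ p := Nat.pow_log_le_self 2 (by omega)
  have hpb' : p < 2 ^ (b + 1) := Nat.lt_pow_succ_log_self (by norm_num) p
  set i := b - s with hi
  set d := 2 ^ i with hd
  have hd0 : 0 < d := by positivity
  -- `c` = least multiple of `d` that is `≥ p`
  set c := d * ((p + d - 1) / d) with hc
  have hpc : p ≤ c := by
    have h := Nat.lt_div_mul_add hd0 (a := p + d - 1)
    rw [hc, mul_comm]
    omega
  have hcp : c ≤ p + d - 1 := by
    rw [hc, mul_comm]
    exact Nat.div_mul_le_self _ _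
  have hdc : d ∣ c := Dvd.intro _ rfl
  -- `c ≤ 2^(b+1)` since `2^(b+1)` is a multiple of `d` above `p`
  have hib : i ≤ b + 1 := by omega
  have hpow : 2 ^ (b + 1) = d * 2 ^ (b + 1 - i) := by
    rw [hd, ← pow_add]
    congr 1
    omega
  have hc2 : c ≤ 2 ^ (b + 1) := by
    rw [hc, hpow]
    refine Nat.mul_le_mul_left _ ?_
    refine Nat.le_of_lt_succ ((Nat.div_lt_iff_lt_mul hd0).mpr ?_)
    have : p ≤ 2 ^ (b + 1 - i) * d := by rw [mul_comm, ← hpow]; exact hpb'.le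
    have hsm : (2 ^ (b + 1 - i)).succ * d = 2 ^ (b + 1 - i) * d + d := Nat.succ_mul _ _
    rw [hsm]
    omega
  -- `2^s d ≤ p` when `s ≤ b`; otherwise `d = 1` and `c = p`
  refine ⟨c, hpc, ?_, ?_, hc2⟩
  · -- admissibility: `log₂ c ∈ {b, b+1}`
    rcases eq_or_lt_of_le hc2 with hceq | hclt
    · rw [hceq, Nat.log_pow (by norm_num)]
      exact pow_dvd_pow 2 (by omega)
    · have hlogc : Nat.log 2 c = b :=
        Nat.log_eq_of_pow_le_of_lt_pow (hpb.trans hpc) hclt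
      rw [hlogc]
      exact hdc
  · by_cases hsb : s ≤ b
    · have h2sd : 2 ^ s * d ≤ p := by
        rw [hd, ← pow_add, show s + i = b by omega]
        exact hpb
      calc 2 ^ s * c ≤ 2 ^ s * (p + d - 1) := Nat.mul_le_mul_left _ hcp
        _ ≤ 2 ^ s * p + 2 ^ s * d := by
            rw [← Nat.mul_add]
            exact Nat.mul_le_mul_left _ (by omega)
        _ ≤ 2 ^ s * p + p := by omega
    · have hi0 : i = 0 := by omega
      have hd1 : d = 1 := by rw [hd, hi0, pow_zero]
      have hceq : c = p := by
        apply le_antisymm _ hpc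
        calc c ≤ p + d - 1 := hcp
          _ = p := by rw [hd1]; omega
      rw [hceq]
      omega

/-- **The binary-rounding block map.**  For every `s` there is `V : ℕ → ℕ` with, for all `p ≥ 1`: `p ≤ V p`; `V p` is
`s`-admissible (`2^{⌊log₂ V p⌋ − s} ∣ V p`); `V p ≤ t` for every `s`-admissible `t ≥ p` (so `V` is a monotone ceiling map
onto the `s`-admissible integers); `2^s V p ≤ 2^s p + p`; and `V p ≤ 2^{⌊log₂ p⌋+1}`. [folklore] -/
theorem exists_binaryRound (s : ℕ) : ∃ V : ℕ → ℕ, ∀ p : ℕ, 1 ≤ p →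
    p ≤ V p ∧ 2 ^ (Nat.log 2 (V p) - s) ∣ V p ∧
    (∀ t : ℕ, p ≤ t → 2 ^ (Nat.log 2 t - s) ∣ t → V p ≤ t) ∧
    2 ^ s * V p ≤ 2 ^ s * p + p ∧ V p ≤ 2 ^ (Nat.log 2 p + 1) := by
  classical
  -- existence of an admissible integer above every `p`
  have hex : ∀ p : ℕ, ∃ t : ℕ, p ≤ t ∧ 2 ^ (Nat.log 2 t - s) ∣ t := fun p =>
    ⟨2 ^ (Nat.log 2 p + 1), (Nat.lt_pow_succ_log_self (by norm_num) p).le, by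
      rw [Nat.log_pow (by norm_num)]
      exact pow_dvd_pow 2 (by omega)⟩
  refine ⟨fun p => Nat.find (hex p), fun p hp => ?_⟩
  have hspec := Nat.find_spec (hex p)
  have hmin : ∀ t : ℕ, p ≤ t → 2 ^ (Nat.log 2 t - s) ∣ t → Nat.find (hex p) ≤ t :=
    fun t hpt hadm => Nat.find_min' (hex p) ⟨hpt, hadm⟩
  obtain ⟨c, hpc, hadm, hshort, hc2⟩ := exists_admissible_ge s p hp
  have hVc : Nat.find (hex p) ≤ c := hmin c hpc hadm
  exact ⟨hspec.1, hspec.2, hmin, le_trans (Nat.mul_le_mul_left _ hVc) hshort, hVc.trans hc2⟩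

/-- Consequences for a block map `V` as in `exists_binaryRound`, on any set `P` of positive integers: it is monotone on
`P`, and it is a ceiling map onto its image (`V p ≤ v` for `p ≤ v`, `v = V p'`). [folklore] -/
theorem binaryRound_mono_ceiling (s : ℕ) (V : ℕ → ℕ)
    (hV : ∀ p : ℕ, 1 ≤ p → p ≤ V p ∧ 2 ^ (Nat.log 2 (V p) - s) ∣ V p ∧
      (∀ t : ℕ, p ≤ t → 2 ^ (Nat.log 2 t - s) ∣ t → V p ≤ t) ∧
      2 ^ s * V p ≤ 2 ^ s * p + p ∧ V p ≤ 2 ^ (Nat.log 2 p + 1))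
    (P : Finset ℕ) (hP : ∀ p ∈ P, 1 ≤ p) :
    (∀ p ∈ P, ∀ p' ∈ P, p ≤ p' → V p ≤ V p') ∧
      (∀ v ∈ P.image V, ∀ p ∈ P, p ≤ v → V p ≤ v) := by
  refine ⟨fun p hp p' hp' hpp' => ?_, fun v hv p hp hpv => ?_⟩
  · obtain ⟨hle', hadm', -, -, -⟩ := hV p' (hP p' hp')
    exact (hV p (hP p hp)).2.2.1 (V p') (hpp'.trans hle') hadm'
  · obtain ⟨p', hp', rfl⟩ := Finset.mem_image.mp hv
    exact (hV p (hP p hp)).2.2.1 (V p') hpv (hV p' (hP p' hp')).2.1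

/-- The values of such a `V` on `(2^A, 2^B]` (`A ≥ s`... no hypothesis needed beyond positivity) have the form `2^i · m` with
`2^s ≤ m < 2^(s+1)` (when `⌊log₂ (V p)⌋ ≥ s`) — recorded as: `V p = 2^(⌊log₂ V p⌋ − s) · (V p / 2^(⌊log₂ V p⌋ − s))` with the
quotient in `[2^min(s,⌊log₂ V p⌋), 2^(s+1))` and `⌊log₂ p⌋ ≤ ⌊log₂ V p⌋ ≤ ⌊log₂ p⌋ + 1`. [folklore] -/
theorem binaryRound_value_shape (s : ℕ) (V : ℕ → ℕ)
    (hV : ∀ p : ℕ, 1 ≤ p → p ≤ V p ∧ 2 ^ (Nat.log 2 (V p) - s) ∣ V p ∧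
      (∀ t : ℕ, p ≤ t → 2 ^ (Nat.log 2 t - s) ∣ t → V p ≤ t) ∧
      2 ^ s * V p ≤ 2 ^ s * p + p ∧ V p ≤ 2 ^ (Nat.log 2 p + 1))
    (p : ℕ) (hp : 1 ≤ p) :
    V p = 2 ^ (Nat.log 2 (V p) - s) * (V p / 2 ^ (Nat.log 2 (V p) - s)) ∧
      V p / 2 ^ (Nat.log 2 (V p) - s) < 2 ^ (s + 1) ∧
      Nat.log 2 p ≤ Nat.log 2 (V p) ∧ Nat.log 2 (V p) ≤ Nat.log 2 p + 1 := by
  obtain ⟨hle, hadm, -, -, hup⟩ := hV p hp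
  have hV0 : V p ≠ 0 := by omega
  set b := Nat.log 2 (V p) with hb
  have hlow : 2 ^ b ≤ V p := Nat.pow_log_le_self 2 hV0
  have hhigh : V p < 2 ^ (b + 1) := Nat.lt_pow_succ_log_self (by norm_num) _
  refine ⟨(Nat.mul_div_cancel' hadm).symm, ?_, Nat.log_mono_right hle, ?_⟩
  · refine (Nat.div_lt_iff_lt_mul (by positivity)).mpr ?_
    calc V p < 2 ^ (b + 1) := hhigh
      _ ≤ 2 ^ (s + 1) * 2 ^ (b - s) := by
          rw [← pow_add]
          exact Nat.pow_le_pow_right (by norm_num) (by omega)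
  · calc Nat.log 2 (V p) ≤ Nat.log 2 (2 ^ (Nat.log 2 p + 1)) := Nat.log_mono_right hup
      _ = Nat.log 2 p + 1 := Nat.log_pow (by norm_num) _

end Summit.ValiantsHypothesis.ValiantsHypothesis.Theorems.LiouvilleSarnak.AlignedTypeI.CharactersModTwoN
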